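import Summits.Ventures.Crystal3D.Theorems.StickyWulffConstantCoaxialWallLawOneFccCoreCell
import Summits.Ventures.Crystal3D.Theorems.StickyWulffConstantCoaxialWallLawOneFccMirrorCell
import Summits.Ventures.Crystal3D.Theorems.StickyWulffConstantTextureLiminfTexShadowOneFccCharge
import Summits.Ventures.Crystal3D.Theorems.StickyWulffConstantTextureLiminfTexShadowOneFccFrames
import Summits.Ventures.Crystal3D.Theorems.StickyWulffConstantTextureLiminfTexShadowBilayerFrameAxis
import Summits.Ventures.Crystal3D.Theorems.StickyWulffConstantTextureLiminfTexShadowFLayerSplitDefs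
import Summits.Ventures.Crystal3D.Theorems.StickyWulffConstantTextureLiminfBilayerWallBookkeeping
import Summits.Ventures.Crystal3D.Theorems.StickyWulffConstantCoaxialWallLawEndRowDefsA
import HarnessLib

/-!
# The ONE-FCC F_layer LAW from the twin row: `∃ C, FLayerTwinFamilyOneFccAt (13/25) C 10` (file (l₂), the assembly)

HONEST FRAMING. Venture `Summits/Ventures/Crystal3D` (cell `crystal3d-full`); helper `--supports` the crux `CoaxialWallLaw`
(stmt-Ventures-19481, REGISTERED line `WallLedgerF`) in its role as owner of lane T's debt T-F2 / F_layer, OneFcc half: TexShadow v8.4's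
`stub_fLayerOneFcc : ∃ C, FLayerTwinFamilyOneFccAt (13/25) C 10` (crux `TextureLiminfV5`, stmt-Ventures-23912; cf-p1 (civ)/(cx)/(cxx);
memos HOME/wall-19481-p1/g15/ONEFCC-ASSEMBLY-PLAN-g15.md, HOME/wall-19481-p1/g16/TWO-FAMILY-LEDGER-g16.md).
**CONDITIONAL**: the inputs `KissingGap δ`, `KissingClassification δ` (the kissing facts of the word net) and the TWIN ROW OF RECORD
`EndRowTwinHalfTurnA ver sF` with `sF · √(2/3) ≤ 4` (e.g. `sF = 9/2`) are taken BY NAME — they are exactly the census-side content of the crux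
`CoaxialWallLaw`; this file discharges everything else.  Census-free, standard axioms; nothing about the crux is claimed; F-C1 not moved.

**`fLayerOneFcc_of_twinRow`** — `KissingGap δ → KissingClassification δ → 0 ≤ sF → sF·√(2/3) ≤ 4 → EndRowTwinHalfTurnA ver sF →
∃ C, FLayerTwinFamilyOneFccAt (13/25) C 10`, with `C = ((864 sF + 430000)·11 + 3456 + 1152·11)/2`.
Per cell (`bilayerWallAt_of_payerBound`, …BilayerWallBookkeeping): the frame dictionary `oneFcc_frame_dictionary` (…TexShadowOneFccFrames)
and the charge law `two_charge_le_mismatch_of_twinFamilyAt(_top)` (…TexShadowOneFccCharge, `P :=` the faulted plate's frame) turn the charge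
into `Σ'_i sin θ · [σ_F i = t] · |S ∩ slab_i|`, which `oneFcc_core_cell` (…OneFccCoreCell) pays — directly when the faulted plate is below,
through the mirrored cell (…OneFccMirrorCell, slice height `h − 1`) when it is above; radius `ρ < 12` and vertical c-axis (`sin θ = 0`) are
the trivial cases (`two_charge_le_const`).
WHAT THIS IS NOT: not the BothFaulted half of T-F2, not the census row, not the kissing facts; F-C1 not moved.
-/

noncomputable section

namespace Summit.Ventures.Crystal3D.Theorems

open MeasureTheory Summit.Ventures.Crystal3D Finset
open Literature.MathematicalPhysics.StatisticalMechanics (IsHaggSeq basalMirror basalMirror_apply_coord basalMirror_basalMirror)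
open Summit.Ventures.Crystal3D.Cruxes.TextureLiminf.TexShadow (E3 e₃ fccRef stacking laySlab cyl BilayerWallAt BilayerFramesAt
  InTwinFamily BilayerChargeAdmissibleAt BothFcc FLayerTwinFamilyOneFccAt)
open scoped InnerProductSpace

/-- `⟪L e₃, e₃⟫ = (L⁻¹ e₃)₂`. -/
theorem inner_frame_e₃_eq_symm_two (L : E3 ≃ₗᵢ[ℝ] E3) :
    ⟪L e₃, e₃⟫_ℝ = (L.symm (EuclideanSpace.single (2 : Fin 3) (1 : ℝ))) 2 := by
  rw [apply_two_eq_inner_symm L.symm, LinearIsometryEquiv.symm_symm, real_inner_comm]; rfl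

/-- The fcc plate's lattice is the basal twin of the root frame's: `Gf Λ₀ ∈ {L Λ₀, (bM ≫ L) Λ₀}` for `Fr ∈ {L, bM ≫ L}`. -/
theorem oneFcc_D_cases {L Fr Gf : E3 ≃ₗᵢ[ℝ] E3} {t : ℤ} (hFr : (t = 1 ∧ Fr = L) ∨ (t = -1 ∧ Fr = basalMirror.trans L))
    (hdozen : (Gf : E3 → E3) '' ↑fccSlots = (fun x => Fr (basalMirror x)) '' ↑fccSlots) :
    Gf '' fccRef = L '' fccRef ∨ Gf '' fccRef = (basalMirror.trans L) '' fccRef := by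
  have hΛ : Gf '' fccRef = (basalMirror.trans Fr) '' fccRef := image_fccRef_eq_of_image_fccSlots_eq (by rw [hdozen]; rfl)
  rcases hFr with ⟨-, hF⟩ | ⟨-, hF⟩
  · exact Or.inr (by rw [hΛ, hF])
  · refine Or.inl ?_
    rw [hΛ, hF]
    have : ((basalMirror.trans (basalMirror.trans L) : E3 ≃ₗᵢ[ℝ] E3) : E3 → E3) = L :=
      funext fun x => by simp only [LinearIsometryEquiv.coe_trans, Function.comp_apply, basalMirror_basalMirror]
    rw [this]

/-- The mismatch indicator of the charge law is `sin θ · [σ i = t]`. -/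
theorem oneFcc_indicator {σ : ℤ → ℤ} {t : ℤ} {A : ℤ → (E3 ≃ₗᵢ[ℝ] E3)} {D : Set E3} (L : E3 ≃ₗᵢ[ℝ] E3)
    (hA : ∀ i, A i '' fccRef ≠ D ↔ σ i = t) (i : ℤ) :
    (if A i '' fccRef = D then (0 : ℝ) else Real.sqrt (1 - ⟪L e₃, e₃⟫_ℝ ^ 2)) =
      Real.sqrt (1 - (L.symm (EuclideanSpace.single (2 : Fin 3) (1 : ℝ))) 2 ^ 2) * (if σ i = t then (1 : ℝ) else 0) := by
  classical
  by_cases hi : σ i = t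
  · rw [if_neg ((hA i).2 hi), if_pos hi, mul_one, inner_frame_e₃_eq_symm_two]
  · have : A i '' fccRef = D := by by_contra hne; exact hi ((hA i).1 hne)
    rw [if_pos this, if_neg hi, mul_zero]

open scoped Classical in
/-- **THE ONE-FCC F_layer LAW FROM THE TWIN ROW.**  See the module docstring. -/
theorem fLayerOneFcc_of_twinRow (ver : WordVersion) {δ : ℝ} (hg : KissingGap δ) (hc : KissingClassification δ)
    {sF : ℝ} (hsF : 0 ≤ sF) (hsFd : sF * Real.sqrt (2 / 3) ≤ 4) (hrow : EndRowTwinHalfTurnA ver sF) :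
    ∃ C : ℝ, FLayerTwinFamilyOneFccAt (13 / 25) C 10 := by
  refine ⟨((864 * sF + 430000) * (1 + 10) + 3456 + 1152 * (10 + 1)) / 2, ?_⟩
  intro σ₁ σ₂ hσ₁ hσ₂ hconst hnot L₁ L₂ P s₁ s₂ A₁ A₂ u₁ u₂ hfr₁ hfr₂ hf₁ hf₂ c m hadm
  refine bilayerWallAt_of_payerBound hσ₁ hσ₂ L₁ L₂ s₁ s₂ 10 ((864 * sF + 430000) * (1 + 10)) (by norm_num) c ?_
  intro h hh ρ hρ X P₁ P₂ hX hP₁X hP₂X hcyl hP₁ hP₂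
  have hP₂X' : P₂ ⊆ X := fun p hp => (Finset.mem_sdiff.1 (hP₂X hp)).1
  have hcell : ∀ p ∈ X, -(2 * (10 : ℝ)) ≤ p 2 ∧ p 2 ≤ h + 2 * 10 ∧ p 0 ^ 2 + p 1 ^ 2 ≤ ρ ^ 2 := fun p hp => hcyl p hp
  set S : Set E3 := {q : E3 | 0 ≤ q 2 ∧ q 2 ≤ 1 ∧ q 0 ^ 2 + q 1 ^ 2 ≤ ρ ^ 2} with hS
  have hρ0 : (0 : ℝ) ≤ ρ := by linarith
  have hSm : MeasurableSet S := measurableSet_wallSlice ρ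
  have hSvol : volume S = ENNReal.ofReal (Real.pi * ρ ^ 2) := volume_wallSlice ρ hρ0
  have hSfin : volume S ≠ ⊤ := by rw [hSvol]; exact ENNReal.ofReal_ne_top
  have hPAY0 : (0 : ℝ) ≤ ∑ y ∈ X.filter (fun y => (X.filter fun q => dist y q = 1).card ≠ 12 ∧ -(10 : ℝ) - 2 ≤ y 2 ∧ y 2 ≤ h + 10 + 2),
      ((12 : ℝ) - ((X.filter fun q => dist y q = 1).card : ℝ)) := by
    refine sum_nonneg fun y _ => ?_
    have : ((X.filter fun q => dist y q = 1).card : ℝ) ≤ 12 := by exact_mod_cast card_filter_dist_eq_one_le_twelve X hX y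
    linarith
  have hC0 : 0 ≤ (864 * sF + 430000) * (1 + 10) * (1 + h) * ρ := by positivity
  -- ### small cells: the trivial bound
  by_cases hρ12 : ρ < 12
  · have hsmall := two_charge_le_const L₁ L₂ s₁ s₂ c (13 / 25) hadm.1 hadm.2.1 S hSm hSfin
    rw [hSvol, ENNReal.toReal_ofReal (by positivity)] at hsmall
    have h1 : Real.pi * ρ ^ 2 ≤ 4 * (12 * ρ) := by nlinarith [Real.pi_le_four, Real.pi_pos, hρ0, hρ12]
    have hm1 : 0 ≤ sF * ρ := mul_nonneg hsF hρ0
    have hm2 : 0 ≤ sF * h * ρ := mul_nonneg (mul_nonneg hsF hh) hρ0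
    have hm3 : 0 ≤ h * ρ := mul_nonneg hh hρ0
    linarith only [hsmall, h1, hPAY0, hm1, hm2, hm3, hρ0]
  push Not at hρ12
  rcases hconst with hc1 | hc2
  · -- ### case I: the fcc plate below, the faulted plate above — the mirrored cell
    have hnc : ¬ (∀ k : ℤ, σ₂ k = σ₂ 0) := fun h2 => hnot ⟨hc1, h2⟩
    obtain ⟨Gf, Fr, t, hGf, hFr, hA₁, hdozen, hA₂⟩ :=
      oneFcc_frame_dictionary hσ₂ hσ₁ hnc (hσ₁ 0) (fun n => hc1 n) L₂ L₁ P s₂ s₁ hfr₂ hfr₁ hf₂ hf₁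
    have h₂ : ∀ j, A₂ j '' fccRef = L₂ '' fccRef ∨ A₂ j '' fccRef = (basalMirror.trans L₂) '' fccRef :=
      fun j => bilayerFrame_image_eq_frame_or_basalTwin hσ₂ hfr₂ j
    have hD := oneFcc_D_cases hFr hdozen
    have hQ := two_charge_le_mismatch_of_twinFamilyAt_top (c₀ := 13 / 25) (by norm_num) L₁ L₂ s₁ s₂ (P := L₂) (D := Gf '' fccRef)
      hD hA₁ h₂ hadm S hSm hSfin
    simp only [oneFcc_indicator L₂ hA₂] at hQ
    by_cases hS2 : 0 < 1 - (L₂.symm (EuclideanSpace.single (2 : Fin 3) (1 : ℝ))) 2 ^ 2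
    · -- the mirrored cell
      have hFr' : (t = 1 ∧ Fr.trans basalMirror = L₂.trans basalMirror) ∨
          (t = -1 ∧ Fr.trans basalMirror = basalMirror.trans (L₂.trans basalMirror)) := by
        rcases hFr with ⟨h1, h2⟩ | ⟨h1, h2⟩
        · exact Or.inl ⟨h1, by rw [h2]⟩
        · exact Or.inr ⟨h1, by rw [h2]; exact LinearIsometryEquiv.ext fun x => rfl⟩
      have hGf' : (σ₁ 0 = 1 ∧ Gf.trans basalMirror = L₁.trans basalMirror) ∨
          (σ₁ 0 = -1 ∧ Gf.trans basalMirror = basalMirror.trans (L₁.trans basalMirror)) := by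
        rcases hGf with ⟨h1, h2⟩ | ⟨h1, h2⟩
        · exact Or.inl ⟨h1, by rw [h2]⟩
        · exact Or.inr ⟨h1, by rw [h2]; exact LinearIsometryEquiv.ext fun x => rfl⟩
      have hdozen' : ((Gf.trans basalMirror : E3 ≃ₗᵢ[ℝ] E3) : E3 → E3) '' ↑fccSlots =
          (fun x => (Fr.trans basalMirror) (basalMirror x)) '' ↑fccSlots := by
        have e1 : ((Gf.trans basalMirror : E3 ≃ₗᵢ[ℝ] E3) : E3 → E3) = basalMirror ∘ Gf := rfl
        have e2 : (fun x => (Fr.trans basalMirror) (basalMirror x)) = basalMirror ∘ (fun x => Fr (basalMirror x)) := rfl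
        rw [e1, e2, Set.image_comp, Set.image_comp, hdozen]
      have hS2' : 0 < 1 - ((L₂.trans basalMirror).symm (EuclideanSpace.single (2 : Fin 3) (1 : ℝ))) 2 ^ 2 := by
        rw [symm_e₃_two_trans_basalMirror, neg_sq]; exact hS2
      have hcore := oneFcc_core_cell ver hg hc hσ₂ (L₂.trans basalMirror) (L₁.trans basalMirror)
        (basalMirror s₂ + h • EuclideanSpace.single (2 : Fin 3) (1 : ℝ)) (basalMirror s₁ + h • EuclideanSpace.single (2 : Fin 3) (1 : ℝ))
        (Fr.trans basalMirror) hFr' (Gf.trans basalMirror) hGf' (fun n => hc1 n) hdozen' hsF hsFd (hrow _)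
        (X.image fun q => basalMirror q + h • EuclideanSpace.single (2 : Fin 3) (1 : ℝ))
        (P₂.image fun q => basalMirror q + h • EuclideanSpace.single (2 : Fin 3) (1 : ℝ))
        (P₁.image fun q => basalMirror q + h • EuclideanSpace.single (2 : Fin 3) (1 : ℝ))
        10 h ρ (h - 1) (by norm_num) hh (by linarith) (by linarith) (by linarith)
        (mirrorCell_separated X hX _) (image_subset_image hP₂X') (image_subset_image hP₁X) (mirrorCell_cell X 10 h ρ hcell)
        (mirrorCell_plate_bottom P₂ L₂ s₂ σ₂ 10 h ρ hP₂) (mirrorCell_plate_top P₁ L₁ s₁ σ₁ 10 h ρ hP₁) hS2'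
      rw [mirrorCell_payerSum_eq X 10 h] at hcore
      simp only [volume_mirrorSlice_inter_laySlab, symm_e₃_two_trans_basalMirror, neg_sq] at hcore
      linarith only [hQ, hcore]
    · have h0 : Real.sqrt (1 - (L₂.symm (EuclideanSpace.single (2 : Fin 3) (1 : ℝ))) 2 ^ 2) = 0 :=
        Real.sqrt_eq_zero'.2 (not_lt.1 hS2)
      rw [h0] at hQ
      simp only [zero_mul, tsum_zero] at hQ
      linarith only [hQ, hPAY0, hC0]
  · -- ### case II: the faulted plate below, the fcc plate above
    have hnc : ¬ (∀ k : ℤ, σ₁ k = σ₁ 0) := fun h1 => hnot ⟨h1, hc2⟩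
    obtain ⟨Gf, Fr, t, hGf, hFr, hA₂, hdozen, hA₁⟩ :=
      oneFcc_frame_dictionary hσ₁ hσ₂ hnc (hσ₂ 0) (fun n => hc2 n) L₁ L₂ P s₁ s₂ hfr₁ hfr₂ hf₁ hf₂
    have h₁ : ∀ i, A₁ i '' fccRef = L₁ '' fccRef ∨ A₁ i '' fccRef = (basalMirror.trans L₁) '' fccRef :=
      fun i => bilayerFrame_image_eq_frame_or_basalTwin hσ₁ hfr₁ i
    have hD := oneFcc_D_cases hFr hdozen
    have hQ := two_charge_le_mismatch_of_twinFamilyAt (c₀ := 13 / 25) (by norm_num) L₁ L₂ s₁ s₂ (P := L₁) (D := Gf '' fccRef)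
      h₁ hD hA₂ hadm S hSm hSfin
    simp only [oneFcc_indicator L₁ hA₁] at hQ
    by_cases hS2 : 0 < 1 - (L₁.symm (EuclideanSpace.single (2 : Fin 3) (1 : ℝ))) 2 ^ 2
    · have hcore := oneFcc_core_cell ver hg hc hσ₁ L₁ L₂ s₁ s₂ Fr hFr Gf hGf (fun n => hc2 n) hdozen hsF hsFd (hrow Fr) X P₁ P₂
        10 h ρ 0 (by norm_num) hh (by linarith) (by norm_num) hh hX hP₁X hP₂X' hcell hP₁ hP₂ hS2
      simp only [zero_add] at hcore
      linarith only [hQ, hcore]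
    · have h0 : Real.sqrt (1 - (L₁.symm (EuclideanSpace.single (2 : Fin 3) (1 : ℝ))) 2 ^ 2) = 0 :=
        Real.sqrt_eq_zero'.2 (not_lt.1 hS2)
      rw [h0] at hQ
      simp only [zero_mul, tsum_zero] at hQ
      linarith only [hQ, hPAY0, hC0]

end Summit.Ventures.Crystal3D.Theorems

end
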